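import Summits.SmoothPoincare4.SmoothPoincare4.Theorems.ConvexBisectionSphereSeamStandard
import Mathlib.Geometry.Manifold.Diffeomorph
import Literature.Topology.FourManifolds.CerfGammaFour
import Literature.Topology.FourManifolds.Cobordism
import Literature.Topology.FourManifolds.ClosedBall
import Literature.Topology.FourManifolds.CorkDecomposition
import Literature.Topology.FourManifolds.TwistedSpheres

/-!
# Bisections with two ball certificates are `S⁴` modulo Cerf
(helper for item stmt-SmoothPoincare4-15001 `SmoothSphereSeamStandard`, route
route-SmoothPoincare4-ConvexBisection)

The item `SmoothSphereSeamStandard` absorbs a Stein bisection of `M ≃ₕ S⁴` one of whose halves is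
certified to be bounded by a smooth `S³`; its proof (Eliashberg twice, then Cerf) ends with the
purely topological step isolated here: if BOTH halves of a bisection `M = e₁(W₁) ∪ e₂(W₂)` (two
compact `4`-manifolds with boundary smoothly embedded in a Hausdorff second countable smooth
`4`-manifold, meeting exactly along the images of both boundaries) come with ball certificates
`Φᵢ : Wᵢ ≅ 𝔻⁴`, then `M` is a twisted sphere `𝔻⁴ ∪_χ 𝔻⁴`, hence `M ≅ S⁴` by Cerf's `Γ₄ = 0`
(`Literature.Topology.FourManifolds.cerf_twistedSphere_four`, a named fact taken as hypothesis) —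
no Stein structures and no filling theorem.  The seam diffeomorphism is
`exists_seamDiffeomorph` (`Theorems/ConvexBisectionSphereSeamStandard.lean`), the transport
`Literature.Topology.FourManifolds.IsBoundaryGluing.transfer`.

## References

* M. Kervaire, J. Milnor, *Groups of homotopy spheres I*, Ann. of Math. 77 (1963), §1.
  [KervaireMilnor1963]
* J. Cerf, *Sur les difféomorphismes de la sphère de dimension trois (Γ₄ = 0)*, LNM 53 (1968).
  [CerfDiffeoSphere1968]
-/

noncomputable section

-- the prescribed namespace `Summit.<P>.<Sub>.…` duplicates `SmoothPoincare4` (P = Sub)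
set_option linter.dupNamespace false

open scoped Manifold ContDiff Topology
open Set Function Literature.Topology.FourManifolds

namespace Summit.SmoothPoincare4.SmoothPoincare4.Theorems

/-- **Two ball certificates need only Cerf.**  If a Hausdorff second countable smooth
`4`-manifold `M` is covered by two smoothly embedded compact `4`-manifolds with boundary `W₁`, `W₂`
meeting exactly along the images of both boundaries, and BOTH halves come with diffeomorphisms
`Φ₁ : W₁ ≅ 𝔻⁴`, `Φ₂ : W₂ ≅ 𝔻⁴`, then `M ≅ S⁴` conditionally on Cerf's `Γ₄ = 0` alone — no Stein
structures and no filling theorem: `M = W₁ ∪_ψ W₂` along the seam diffeomorphism `ψ : ∂W₁ ≅ ∂W₂`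
(`exists_seamDiffeomorph`), transported along `Φ₁⁻¹`, `Φ₂⁻¹` (`IsBoundaryGluing.transfer`), is a
twisted sphere `𝔻⁴ ∪_χ 𝔻⁴`.  This isolates steps (4)–(5) of
`nonempty_diffeomorph_sphere_four_of_steinBisection_of_diffeomorph` for walks that certify both
blocks as balls (e.g. doubles).  Kervaire–Milnor (1963), §1; Cerf (1968).
[cite: KervaireMilnor1963, §1] -/
theorem nonempty_diffeomorph_sphere_four_of_bisection_of_ballCertificates
    (hCerf : cerf_twistedSphere_four)
    (M : Type) [TopologicalSpace M] [T2Space M] [SecondCountableTopology M]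
    [ChartedSpace (EuclideanSpace ℝ (Fin 4)) M] [IsManifold (𝓡 4) ∞ M]
    (W₁ : Type) [TopologicalSpace W₁] [ChartedSpace (EuclideanHalfSpace 4) W₁]
    [IsManifold (𝓡∂ 4) ∞ W₁] [CompactSpace W₁]
    (W₂ : Type) [TopologicalSpace W₂] [ChartedSpace (EuclideanHalfSpace 4) W₂]
    [IsManifold (𝓡∂ 4) ∞ W₂] [CompactSpace W₂] (e₁ : W₁ → M) (e₂ : W₂ → M)
    (he₁ : Manifold.IsSmoothEmbedding (𝓡∂ 4) (𝓡 4) ∞ e₁)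
    (he₂ : Manifold.IsSmoothEmbedding (𝓡∂ 4) (𝓡 4) ∞ e₂)
    (hcover : range e₁ ∪ range e₂ = univ)
    (hseam₁ : range e₁ ∩ range e₂ = e₁ '' (𝓡∂ 4).boundary W₁)
    (hseam₂ : range e₁ ∩ range e₂ = e₂ '' (𝓡∂ 4).boundary W₂)
    (Φ₁ : W₁ ≃ₘ⟮𝓡∂ 4, 𝓡∂ 4⟯ Metric.closedBall (0 : EuclideanSpace ℝ (Fin 4)) 1)
    (Φ₂ : W₂ ≃ₘ⟮𝓡∂ 4, 𝓡∂ 4⟯ Metric.closedBall (0 : EuclideanSpace ℝ (Fin 4)) 1) :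
    Nonempty (M ≃ₘ⟮𝓡 4, 𝓡 4⟯ Metric.sphere (0 : EuclideanSpace ℝ (Fin 5)) 1) := by
  -- `M` is compact; the halves are Hausdorff and second countable (embedded in `M`); boundary data
  haveI : CompactSpace M := ⟨by
    rw [← hcover]
    exact (isCompact_range he₁.isEmbedding.continuous).union
      (isCompact_range he₂.isEmbedding.continuous)⟩
  haveI : T2Space W₁ := he₁.isEmbedding.t2Space
  haveI : T2Space W₂ := he₂.isEmbedding.t2Space
  haveI : SecondCountableTopology W₁ := he₁.isEmbedding.secondCountableTopology
  haveI : SecondCountableTopology W₂ := he₂.isEmbedding.secondCountableTopology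
  obtain ⟨b₁⟩ : Nonempty (BoundaryData (𝓡∂ 4) W₁ (𝓡 3)) := nonempty_boundaryData_holds 3 W₁
  obtain ⟨b₂⟩ : Nonempty (BoundaryData (𝓡∂ 4) W₂ (𝓡 3)) := nonempty_boundaryData_holds 3 W₂
  -- the seam diffeomorphism and the gluing `M = W₁ ∪_ψ W₂`
  obtain ⟨ψ, hψ⟩ := exists_seamDiffeomorph he₁ he₂ hseam₁ hseam₂ b₁ b₂
  have hglue : IsBoundaryGluing b₁ b₂ ψ (𝓡 4) M := by
    refine ⟨e₁, e₂, he₁, he₂, hcover, fun a a' => ⟨fun h => ?_, ?_⟩⟩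
    · have hp : e₁ a ∈ range e₁ ∩ range e₂ := ⟨mem_range_self _, h ▸ mem_range_self _⟩
      rw [hseam₁] at hp
      obtain ⟨w, hw, hww⟩ := hp
      have hb : a ∈ (𝓡∂ 4).boundary W₁ := by rwa [← he₁.isEmbedding.injective hww]
      have ha : a ∈ range b₁.incl := by rw [b₁.range_incl]; exact hb
      obtain ⟨z, rfl⟩ := ha
      refine ⟨z, rfl, he₂.isEmbedding.injective ?_⟩
      rw [hψ z]
      exact h.symm
    · rintro ⟨z, rfl, rfl⟩
      exact (hψ z).symm
  -- transport to the two balls: `M = 𝔻⁴ ∪_χ 𝔻⁴`, and Cerf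
  let D : BoundaryData (𝓡∂ 4) (Metric.closedBall (0 : EuclideanSpace ℝ (Fin 4)) 1) (𝓡 3) :=
    closedBallBoundaryData 3
  have hT₁ : IsBoundaryGluing D b₂ (ψ ∘ D.restrictDiffeomorph b₁ Φ₁.symm) (𝓡 4) M :=
    IsBoundaryGluing.transfer (b₁ := D) Φ₁.symm hglue
  have hT₁' : IsBoundaryGluing D b₂ ⇑((D.restrictDiffeomorph b₁ Φ₁.symm).trans ψ) (𝓡 4) M := hT₁
  have hT₂ : IsBoundaryGluing D D
      (⇑((D.restrictDiffeomorph b₁ Φ₁.symm).trans ψ).symm ∘ D.restrictDiffeomorph b₂ Φ₂.symm)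
      (𝓡 4) M :=
    IsBoundaryGluing.transfer (b₁ := D) Φ₂.symm hT₁'.symm'
  let χ : (Metric.sphere (0 : EuclideanSpace ℝ (Fin 4)) 1) ≃ₘ⟮𝓡 3, 𝓡 3⟯
      (Metric.sphere (0 : EuclideanSpace ℝ (Fin 4)) 1) :=
    (D.restrictDiffeomorph b₂ Φ₂.symm).trans ((D.restrictDiffeomorph b₁ Φ₁.symm).trans ψ).symm
  have hX : IsTwistedSphere 3 χ M := hT₂
  let T : TwistedSphere 3 χ := { carrier := M, isTwistedSphere := hX }
  exact hCerf χ T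

end Summit.SmoothPoincare4.SmoothPoincare4.Theorems

end
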